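import Literature.RingTheory.MvPolynomial.GeomComponentsGaloisAction
import HarnessLib

/-!
# Galois descent of a component singled out by an invariant label

Companion of `Literature.RingTheory.MvPolynomial.GeomComponentsGaloisAction` (Stacks Project,
Tag 04KZ: the geometric irreducible components of a `k`-component form one `Gal(k̄/k)`-orbit; a
component stable under `Gal(K/E)` has at most `[E:k]` conjugates). There, the component through an
`E`-rational point `y` is shown to be `Gal(K/E)`-stable when it is the UNIQUE component through
`y`. The same argument works verbatim when it is merely the unique component through `y` carrying
a `Gal(K/k)`-INVARIANT LABEL `lab` (the Galois action permutes the components through the fixed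
point `y` and preserves `lab`):

* `map_algEquiv_eq_of_forall_apply_eq_of_invariant` — labelled stabiliser lemma;
* `ncard_minimalPrimes_map_le_finrank_of_invariant`,
  `exists_mem_minimalPrimes_ncard_map_le_finrank_of_invariant` — labelled orbit–stabiliser bound
  and labelled component descent;
* `ringKrullDim_quotient_map_algEquiv` — the Krull dimension of `K[X_σ] ⧸ Q` is such a label;
* `exists_mem_minimalPrimes_ncard_map_le_finrank_of_ringKrullDim_eq` — **if exactly one geometric
  component OF A GIVEN DIMENSION passes through the `E`-point `y`, some minimal prime over `I` has
  at most `[E:k]` geometric components** (weaker hypothesis than "exactly one component through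
  `y`": a crossing with components of other dimensions is allowed).

Motivation (route `ValiantsHypothesis/LangWeilTransfer`, crux `ShatteringExclusion`, line
`birth`): the line certifies a tame component by a low-degree point on a UNIQUE component
(`stub_unibranching`, conjecture grade); any Galois-invariant way of singling out one component
through the point is an admissible, weaker certificate. Not here: base change `k̄ ↔ ℂ` of the
labelled condition.

## References
* The Stacks Project, Tag 04KZ (and 038J, 04KY). [StacksProject]
-/

noncomputable section

open MvPolynomial
open scoped Pointwise

namespace Literature.RingTheory.MvPolynomial

variable {k : Type*} [Field k] {K : Type*} [Field K] [Algebra k K] {σ : Type*}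

/-- `map (g * h) = map g ∘ map h` for the coefficientwise action. [folklore] -/
private theorem map_algEquiv_mul' (g h : K ≃ₐ[k] K) :
    MvPolynomial.map (σ := σ) ((g * h : K ≃ₐ[k] K) : K →+* K) =
      (MvPolynomial.map (g : K →+* K)).comp (MvPolynomial.map (h : K →+* K)) := by
  refine RingHom.ext fun p => ?_
  rw [RingHom.comp_apply, MvPolynomial.map_map]
  rfl

/-- `ev_y (pᵍ) = g (ev_y p)` when `g` fixes the point `y`. [folklore] -/
private theorem aeval_map_algEquiv_of_forall_apply_eq' (g : K ≃ₐ[k] K) (y : σ → K)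
    (hy : ∀ v, g (y v) = y v) (p : MvPolynomial σ K) :
    MvPolynomial.aeval y (MvPolynomial.map (g : K →+* K) p) = g (MvPolynomial.aeval y p) := by
  rw [MvPolynomial.aeval_def, MvPolynomial.eval₂_map, MvPolynomial.aeval_def,
    show (g (MvPolynomial.eval₂ (algebraMap K K) y p)) =
      (g : K →+* K) (MvPolynomial.eval₂ (algebraMap K K) y p) from rfl,
    MvPolynomial.eval₂_comp_left]
  congr 1
  ext v
  exact (hy v).symm

/-! ### Labelled variant: a unique component through `y` with a Galois-invariant label -/

/-- **Labelled stabiliser lemma.** Let `lab` be a property of ideals of `K[X_σ]` invariant under the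
coefficientwise `Gal(K/k)`-action. If `g ∈ Gal(K/k)` fixes the point `y ∈ K^σ` and `Q` is the
UNIQUE minimal prime over `I K[X_σ]` inside `𝔪_y = ker (ev_y)` satisfying `lab`, then `Qᵍ = Q`
(`Qᵍ` is again a minimal prime over `I K[X_σ]`, lies in `𝔪_{g y} = 𝔪_y`, and satisfies `lab`).
[cite: StacksProject, Tag 04KZ] -/
theorem map_algEquiv_eq_of_forall_apply_eq_of_invariant (lab : Ideal (MvPolynomial σ K) → Prop)
    (hlab : ∀ (g : K ≃ₐ[k] K) (Q' : Ideal (MvPolynomial σ K)),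
      lab Q' → lab (Q'.map (MvPolynomial.map (g : K →+* K))))
    (g : K ≃ₐ[k] K) (I : Ideal (MvPolynomial σ k)) (y : σ → K) (hy : ∀ v, g (y v) = y v)
    {Q : Ideal (MvPolynomial σ K)}
    (hQ : Q ∈ (I.map (MvPolynomial.map (algebraMap k K))).minimalPrimes) (hlabQ : lab Q)
    (huniq : ∀ Q' ∈ (I.map (MvPolynomial.map (algebraMap k K))).minimalPrimes,
      Q' ≤ RingHom.ker (MvPolynomial.aeval (R := K) y) → lab Q' → Q' = Q)
    (hQy : Q ≤ RingHom.ker (MvPolynomial.aeval (R := K) y)) :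
    Q.map (MvPolynomial.map (g : K →+* K)) = Q := by
  refine huniq _ (map_algEquiv_mem_minimalPrimes_map g I hQ) ?_ (hlab g Q hlabQ)
  rw [Ideal.map_le_iff_le_comap]
  intro p hp
  have h1 : MvPolynomial.aeval y p = 0 := (RingHom.mem_ker).1 (hQy hp)
  rw [Ideal.mem_comap, RingHom.mem_ker, aeval_map_algEquiv_of_forall_apply_eq' g y hy, h1, map_zero]

/-- **Labelled orbit–stabiliser bound.** As `ncard_minimalPrimes_map_le_finrank`, but assuming
only that `Q` is the unique minimal prime over `I K[X_σ]` in `𝔪_y` with a `Gal(K/k)`-invariant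
label `lab`: then `𝔭 = Q ∩ k[X_σ]` has at most `[E : k]` minimal primes over `𝔭 K[X_σ]`.
[cite: StacksProject, Tag 04KZ] -/
theorem ncard_minimalPrimes_map_le_finrank_of_invariant [IsGalois k K] [IsAlgClosed K]
    (lab : Ideal (MvPolynomial σ K) → Prop)
    (hlab : ∀ (g : K ≃ₐ[k] K) (Q' : Ideal (MvPolynomial σ K)),
      lab Q' → lab (Q'.map (MvPolynomial.map (g : K →+* K))))
    (I : Ideal (MvPolynomial σ k)) (y : σ → K) (E : IntermediateField k K)
    [FiniteDimensional k E] (hyE : ∀ v, y v ∈ E) {Q : Ideal (MvPolynomial σ K)}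
    (hQ : Q ∈ (I.map (MvPolynomial.map (algebraMap k K))).minimalPrimes) (hlabQ : lab Q)
    (hQy : Q ≤ RingHom.ker (MvPolynomial.aeval (R := K) y))
    (huniq : ∀ Q' ∈ (I.map (MvPolynomial.map (algebraMap k K))).minimalPrimes,
      Q' ≤ RingHom.ker (MvPolynomial.aeval (R := K) y) → lab Q' → Q' = Q) :
    (((Q.comap (MvPolynomial.map (algebraMap k K))).map
        (MvPolynomial.map (algebraMap k K))).minimalPrimes).ncard ≤ Module.finrank k E := by
  classical
  haveI : Q.IsPrime := hQ.1.1
  set 𝔭 : Ideal (MvPolynomial σ k) := Q.comap (MvPolynomial.map (algebraMap k K)) with h𝔭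
  haveI : 𝔭.IsPrime := Ideal.comap_isPrime _ Q
  have hQ𝔭 : Q ∈ (𝔭.map (MvPolynomial.map (algebraMap k K))).minimalPrimes :=
    mem_minimalPrimes_map_comap_of_mem_minimalPrimes_map I hQ
  -- the orbit map and the restriction map
  let orb : (K ≃ₐ[k] K) → Ideal (MvPolynomial σ K) :=
    fun g => Q.map (MvPolynomial.map (g : K →+* K))
  let res : (K ≃ₐ[k] K) → (E →ₐ[k] K) := fun g => (g : K →ₐ[k] K).comp E.val
  -- `orb` factors through `res`
  have hfac : ∀ g₁ g₂, res g₁ = res g₂ → orb g₁ = orb g₂ := by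
    intro g₁ g₂ hres
    have hfix : ∀ v, (g₁⁻¹ * g₂) (y v) = y v := fun v => by
      have h1 : g₁ (y v) = g₂ (y v) := by
        have := congr_arg (fun f : E →ₐ[k] K => f ⟨y v, hyE v⟩) hres
        exact this
      rw [AlgEquiv.mul_apply, ← h1]
      exact g₁.symm_apply_apply (y v)
    have hstab :=
      map_algEquiv_eq_of_forall_apply_eq_of_invariant lab hlab (g₁⁻¹ * g₂) I y hfix hQ hlabQ huniq hQy
    have hg₂ : g₂ = g₁ * (g₁⁻¹ * g₂) := by group
    change Q.map _ = Q.map _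
    conv_rhs => rw [hg₂, map_algEquiv_mul', ← Ideal.map_map, hstab]
  -- a section of `res` on its image, by choice
  let lift : (E →ₐ[k] K) → Ideal (MvPolynomial σ K) := fun ψ =>
    if hψ : ∃ g, res g = ψ then orb hψ.choose else ⊥
  have hlift : ∀ g, lift (res g) = orb g := fun g => by
    have hψ : ∃ g', res g' = res g := ⟨g, rfl⟩
    simp only [lift, dif_pos hψ]
    exact hfac _ _ hψ.choose_spec
  have hsub : (𝔭.map (MvPolynomial.map (algebraMap k K))).minimalPrimes ⊆ Set.range lift := by
    intro Q' hQ'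
    obtain ⟨g, hg⟩ := exists_map_algEquiv_eq_of_mem_minimalPrimes_map 𝔭 hQ𝔭 hQ'
    exact ⟨res g, by rw [hlift, hg]⟩
  haveI : Algebra.IsSeparable k E := IntermediateField.isSeparable_tower_bot k E
  calc ((𝔭.map (MvPolynomial.map (algebraMap k K))).minimalPrimes).ncard
      ≤ (Set.range lift).ncard := Set.ncard_le_ncard hsub (Set.finite_range lift)
    _ = (lift '' Set.univ).ncard := by rw [Set.image_univ]
    _ ≤ (Set.univ : Set (E →ₐ[k] K)).ncard := Set.ncard_image_le Set.finite_univ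
    _ = Fintype.card (E →ₐ[k] K) := by rw [Set.ncard_univ, Nat.card_eq_fintype_card]
    _ = Module.finrank k E := AlgHom.card k E K

/-- **Labelled component descent**: for `I ⊆ k[X_σ]` (`σ` finite), `E/k` finite inside the
algebraically closed Galois extension `K`, a point `y ∈ E^σ`, and a `Gal(K/k)`-invariant label
`lab` such that EXACTLY ONE minimal prime over `I K[X_σ]` inside `𝔪_y` carries `lab` (e.g. exactly
one geometric component of a given dimension passes through `y`), some minimal prime `𝔭 ⊇ I` has
`0 < #IrredComp(V(𝔭)_K) ≤ [E : k]`. [cite: StacksProject, Tag 04KZ] -/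
theorem exists_mem_minimalPrimes_ncard_map_le_finrank_of_invariant [IsGalois k K] [IsAlgClosed K]
    [Finite σ] (lab : Ideal (MvPolynomial σ K) → Prop)
    (hlab : ∀ (g : K ≃ₐ[k] K) (Q' : Ideal (MvPolynomial σ K)),
      lab Q' → lab (Q'.map (MvPolynomial.map (g : K →+* K))))
    (I : Ideal (MvPolynomial σ k)) (y : σ → K) (E : IntermediateField k K)
    [FiniteDimensional k E] (hyE : ∀ v, y v ∈ E)
    (huniq : ∃! Q : Ideal (MvPolynomial σ K),
      Q ∈ (I.map (MvPolynomial.map (algebraMap k K))).minimalPrimes ∧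
        Q ≤ RingHom.ker (MvPolynomial.aeval (R := K) y) ∧ lab Q) :
    ∃ 𝔭 ∈ I.minimalPrimes,
      0 < ((𝔭.map (MvPolynomial.map (algebraMap k K))).minimalPrimes).ncard ∧
        ((𝔭.map (MvPolynomial.map (algebraMap k K))).minimalPrimes).ncard ≤ Module.finrank k E := by
  obtain ⟨Q, ⟨hQ, hQy, hlabQ⟩, huniq⟩ := huniq
  refine ⟨Q.comap (MvPolynomial.map (algebraMap k K)),
    comap_mem_minimalPrimes_of_mem_minimalPrimes_map I hQ, ?_,
    ncard_minimalPrimes_map_le_finrank_of_invariant lab hlab I y E hyE hQ hlabQ hQy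
      fun Q' hQ' hQ'y hlab' => huniq Q' ⟨hQ', hQ'y, hlab'⟩⟩
  have hmem := mem_minimalPrimes_map_comap_of_mem_minimalPrimes_map I hQ
  have hfin : ((Q.comap (MvPolynomial.map (algebraMap k K))).map
      (MvPolynomial.map (algebraMap k K))).minimalPrimes.Finite :=
    Ideal.finite_minimalPrimes_of_isNoetherianRing (MvPolynomial σ K) _
  exact (Set.ncard_pos hfin).2 ⟨Q, hmem⟩

/-- The Krull dimension of `K[X_σ] ⧸ Q` is a `Gal(K/k)`-invariant label: `map g` is a ring
automorphism of `K[X_σ]` carrying `Q` to `Qᵍ` (the Galois action permutes the irreducible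
components of `X_K` preserving dimension, Stacks Project Tag 04KZ / 0364).
[cite: StacksProject, Tag 04KZ] -/
theorem ringKrullDim_quotient_map_algEquiv (g : K ≃ₐ[k] K) (Q : Ideal (MvPolynomial σ K)) :
    ringKrullDim (MvPolynomial σ K ⧸ Q.map (MvPolynomial.map (g : K →+* K))) =
      ringKrullDim (MvPolynomial σ K ⧸ Q) := by
  set e : MvPolynomial σ K ≃+* MvPolynomial σ K := MvPolynomial.mapEquiv σ (g : K ≃+* K) with he
  have hecoe : (e : MvPolynomial σ K →+* MvPolynomial σ K) = MvPolynomial.map (g : K →+* K) :=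
    RingHom.ext fun p => rfl
  have hQ : Q.map (MvPolynomial.map (g : K →+* K)) =
      Q.map (e : MvPolynomial σ K →+* MvPolynomial σ K) := by rw [hecoe]
  rw [hQ]
  exact (ringKrullDim_eq_of_ringEquiv (Ideal.quotientEquiv Q _ e rfl)).symm

/-- **Component descent from a unique component of given dimension.** If, among the geometric
irreducible components of `V(I)` through the `E`-rational point `y`, exactly one has coordinate
ring of Krull dimension `d`, then some minimal prime `𝔭 ⊇ I` has
`0 < #IrredComp(V(𝔭)_K) ≤ [E : k]` — the unique dimension-`d` component through `y` is stable
under `Gal(K/E)`. (Weaker hypothesis than lying on exactly one component.)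
[cite: StacksProject, Tag 04KZ] -/
theorem exists_mem_minimalPrimes_ncard_map_le_finrank_of_ringKrullDim_eq [IsGalois k K]
    [IsAlgClosed K] [Finite σ] (I : Ideal (MvPolynomial σ k)) (y : σ → K)
    (E : IntermediateField k K) [FiniteDimensional k E] (hyE : ∀ v, y v ∈ E) (d : WithBot ℕ∞)
    (huniq : ∃! Q : Ideal (MvPolynomial σ K),
      Q ∈ (I.map (MvPolynomial.map (algebraMap k K))).minimalPrimes ∧
        Q ≤ RingHom.ker (MvPolynomial.aeval (R := K) y) ∧
          ringKrullDim (MvPolynomial σ K ⧸ Q) = d) :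
    ∃ 𝔭 ∈ I.minimalPrimes,
      0 < ((𝔭.map (MvPolynomial.map (algebraMap k K))).minimalPrimes).ncard ∧
        ((𝔭.map (MvPolynomial.map (algebraMap k K))).minimalPrimes).ncard ≤ Module.finrank k E :=
  exists_mem_minimalPrimes_ncard_map_le_finrank_of_invariant
    (fun Q => ringKrullDim (MvPolynomial σ K ⧸ Q) = d)
    (fun g Q' h => by rw [ringKrullDim_quotient_map_algEquiv g Q']; exact h) I y E hyE huniq

end Literature.RingTheory.MvPolynomial

end
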